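import Summits.Schanuel.Schanuel.Theses.TateNomes
import Literature.NumberTheory.Transcendental.RankOneGridTrdeg
import Literature.Barriers.Schanuel.LargeTranscendenceDegree
import Literature.Barriers.Schanuel.AlgebraicIndependenceOfLogarithms
import Literature.Barriers.Schanuel.NesterenkoModularScopeHolds
import HarnessLib

/-!
# Crux `NomeTransfer` (route `TateNomes`, item stmt-Schanuel-17405) — negative lemmas:
# the bookkeeping threshold is sharp; linear independence + envelope cannot both be dropped

Standing disprover `refuter-cdisprove-stmt-Schanuel-17405-0` (cycle 1, 2026-08-17); companion of
the crux workfile `Cruxes/NomeTransfer/Disproof.lean` (load-bearing analysis of the crux).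

The crux `Summit.Schanuel.Schanuel.Theses.TateNomes.NomeTransfer` is the transcendence-degree
bookkeeping `4(n+k) ≤ trdeg Env(w) ⟹ n ≤ trdeg ℚ(z, e^z)`; line `trdeg-bookkeeping` proves it in
the CORE form where the `3m` adjoined values are arbitrary families `f g h : Fin m → ℂ` and the
threshold is `n + k + 3m` (stubs `stub_envelopeCount`, `stub_spanDescent`, `stub_algPairCost`).
Two unconditional negatives about its load-bearing data:

* `nomeTransferCore_false_below_threshold` — **the threshold `n + k + 3m` is sharp**: lowered to
  `n + k + 3m - 1` the core statement is false. Witness `m = n = 1`, `k = 0`, `w = z = ![0]`,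
  `e = ![]`, `f g h = ![P(1/2)], ![Q(1/2)], ![R(1/2)]` (Ramanujan's functions at the algebraic
  nome `1/2`: three algebraically independent numbers by Nesterenko's theorem, tree
  `nesterenko1996_thm_1_1_holds`), so the envelope `ℚ(0, 1, P(1/2), Q(1/2), R(1/2))` has
  `trdeg ≥ 3 = n + k + 3m - 1` while `trdeg ℚ(0, e^0) = 0 < 1 = n`. Hence any sharpening of the
  crux's constant `4` must use the arithmetic of `P, Q, R` (modular relations), not bookkeeping.
* `nomeTransfer_false_without_linIndep_and_envelope` — dropping BOTH `LinearIndependent ℚ z` and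
  the envelope bound makes the crux false (`z = ![0]`); since `LinearIndependent ℚ z` alone is not
  used by the proof (Disproof.lean §1), the envelope bound is the load-bearing one of the two.
-/

noncomputable section

-- D-0017: the doubled `Schanuel.Schanuel` path component is the mandated summit/sub-problem namespace
set_option linter.dupNamespace false

namespace Summit.Schanuel.Schanuel.Theorems.NomeTransfer.Negative

open Complex IntermediateField
open Literature.Barriers.Schanuel (trdeg_mono trdeg_adjoin_union_eq_of_isAlgebraic ramanujanP
  ramanujanQ ramanujanR nesterenko1996_thm_1_1_holds)
open Literature.NumberTheory.Transcendental (trdeg_adjoin_le_mk)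

/-- A field generated over `ℚ` by algebraic numbers has transcendence degree `0`. [folklore] -/
theorem trdeg_adjoin_eq_zero_of_forall_isAlgebraic (T : Set ℂ) (hT : ∀ x ∈ T, IsAlgebraic ℚ x) :
    Algebra.trdeg ℚ ↥(adjoin ℚ T) = 0 := by
  have h1 : Algebra.trdeg ℚ ↥(adjoin ℚ (∅ ∪ T)) = Algebra.trdeg ℚ ↥(adjoin ℚ (∅ : Set ℂ)) :=
    trdeg_adjoin_union_eq_of_isAlgebraic (K := ℚ) (∅ : Set ℂ) T hT
  have h2 : Algebra.trdeg ℚ ↥(adjoin ℚ (∅ : Set ℂ)) = 0 :=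
    nonpos_iff_eq_zero.mp ((trdeg_adjoin_le_mk (F := ℚ) (∅ : Set ℂ)).trans (by simp))
  have h3 : Algebra.trdeg ℚ ↥(adjoin ℚ T) = Algebra.trdeg ℚ ↥(adjoin ℚ (∅ ∪ T)) := by
    rw [Set.empty_union]
  exact h3.trans (h1.trans h2)

/-- `trdeg ℚ(0, e^0) = 0` for the witness tuple `z = ![0]`. [folklore] -/
theorem trdeg_exp_tuple_zero :
    Algebra.trdeg ℚ ↥(IntermediateField.adjoin ℚ
      (Set.range ![(0 : ℂ)] ∪ Set.range (Complex.exp ∘ ![(0 : ℂ)]))) = 0 := by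
  apply trdeg_adjoin_eq_zero_of_forall_isAlgebraic
  rintro x (⟨i, rfl⟩ | ⟨i, rfl⟩)
  · have : ((![(0 : ℂ)] : Fin 1 → ℂ) i) = 0 := by
      fin_cases i; rfl
    rw [this]; exact isAlgebraic_zero
  · have : (Complex.exp ∘ ![(0 : ℂ)]) i = 1 := by
      fin_cases i; simp
    rw [this]; exact isAlgebraic_one

/-- `¬ (1 ≤ trdeg ℚ(0, e^0))`. [folklore] -/
theorem not_one_le_trdeg_exp_tuple_zero :
    ¬ ((1 : ℕ) : Cardinal) ≤ Algebra.trdeg ℚ ↥(IntermediateField.adjoin ℚ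
      (Set.range ![(0 : ℂ)] ∪ Set.range (Complex.exp ∘ ![(0 : ℂ)]))) := by
  rw [trdeg_exp_tuple_zero]; simp

/-- Nesterenko at the algebraic nome `q = 1/2`: `trdeg ℚ(P(1/2), Q(1/2), R(1/2)) ≥ 3`
(`trdeg ℚ(1/2, P, Q, R) ≥ 3` by `nesterenko1996_thm_1_1_holds`, and `1/2` is algebraic).
[cite: NesterenkoPhilippon2001, Ch. 3 Theorem 1.1] -/
theorem three_le_trdeg_ramanujan_half :
    (3 : Cardinal) ≤ Algebra.trdeg ℚ ↥(adjoin ℚ ({ramanujanP (1 / 2), ramanujanQ (1 / 2),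
      ramanujanR (1 / 2)} : Set ℂ)) := by
  have hq0 : 0 < ‖((1 : ℂ) / 2)‖ := by norm_num
  have hq1 : ‖((1 : ℂ) / 2)‖ < 1 := by norm_num
  have hN := nesterenko1996_thm_1_1_holds ((1 : ℂ) / 2) hq0 hq1
  have halg : ∀ x ∈ ({(1 : ℂ) / 2} : Set ℂ), IsAlgebraic ℚ x := by
    intro x hx
    rw [Set.mem_singleton_iff] at hx
    subst hx
    simpa using isAlgebraic_algebraMap (R := ℚ) (A := ℂ) (1 / 2 : ℚ)
  have heq : Algebra.trdeg ℚ ↥(adjoin ℚ (({ramanujanP (1 / 2), ramanujanQ (1 / 2),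
      ramanujanR (1 / 2)} : Set ℂ) ∪ {(1 : ℂ) / 2})) =
      Algebra.trdeg ℚ ↥(adjoin ℚ ({ramanujanP (1 / 2), ramanujanQ (1 / 2),
        ramanujanR (1 / 2)} : Set ℂ)) :=
    trdeg_adjoin_union_eq_of_isAlgebraic (K := ℚ) _ _ halg
  have hset : ({(1 : ℂ) / 2, ramanujanP (1 / 2), ramanujanQ (1 / 2), ramanujanR (1 / 2)} : Set ℂ) =
      ({ramanujanP (1 / 2), ramanujanQ (1 / 2), ramanujanR (1 / 2)} : Set ℂ) ∪ {(1 : ℂ) / 2} := by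
    ext x; simp only [Set.mem_insert_iff, Set.mem_singleton_iff, Set.mem_union]; tauto
  have hN' : (3 : Cardinal) ≤ Algebra.trdeg ℚ ↥(adjoin ℚ (({ramanujanP (1 / 2), ramanujanQ (1 / 2),
      ramanujanR (1 / 2)} : Set ℂ) ∪ {(1 : ℂ) / 2})) := by
    rw [← hset]; exact hN
  exact hN'.trans heq.le

/-- **Tightness of the bookkeeping threshold of crux `NomeTransfer`** (unconditional). In the core
form proved by line `trdeg-bookkeeping` (arbitrary adjoined families `f g h : Fin m → ℂ`, threshold
`n + k + 3m`; at `m = n + k` and `f g h =` the Ramanujan families this is the crux with its `4(n+k)`),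
the threshold cannot be lowered to `n + k + 3m - 1`: witness `m = n = 1`, `k = 0`, `w = z = ![0]`,
`e = ![]`, `f g h = ![P(1/2)], ![Q(1/2)], ![R(1/2)]` — the envelope `ℚ(0, 1, P(1/2), Q(1/2), R(1/2))`
has `trdeg ≥ 3 = n + k + 3m - 1` (Nesterenko) but `trdeg ℚ(0, e^0) = 0 < 1 = n`. So a sharper
constant in the crux needs arithmetic input on `P, Q, R` (modular relations), not bookkeeping.
[cite: NesterenkoPhilippon2001, Ch. 3 Theorem 1.1] -/
theorem nomeTransferCore_false_below_threshold :
    ¬ (∀ (m n k : ℕ) (w : Fin m → ℂ) (z : Fin n → ℂ) (e : Fin k → ℂ) (f g h : Fin m → ℂ),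
        (∀ i, IsAlgebraic ℚ (e i) ∨ IsAlgebraic ℚ (Complex.exp (e i))) →
        Set.range w ⊆ (Submodule.span ℚ (Set.range z ∪ Set.range e) : Set ℂ) →
        ((n + k + 3 * m - 1 : ℕ) : Cardinal) ≤ Algebra.trdeg ℚ ↥(IntermediateField.adjoin ℚ
          (Set.range w ∪ Set.range (Complex.exp ∘ w) ∪ Set.range f ∪ Set.range g ∪
            Set.range h)) →
        (n : Cardinal) ≤ Algebra.trdeg ℚ ↥(IntermediateField.adjoin ℚ
          (Set.range z ∪ Set.range (Complex.exp ∘ z)))) := by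
  intro h
  refine not_one_le_trdeg_exp_tuple_zero (h 1 1 0 ![0] ![0] ![] ![ramanujanP (1 / 2)]
    ![ramanujanQ (1 / 2)] ![ramanujanR (1 / 2)] (fun i => i.elim0) ?_ ?_)
  · rintro x ⟨i, rfl⟩
    have : ((![(0 : ℂ)] : Fin 1 → ℂ) i) = 0 := by fin_cases i; rfl
    rw [this]
    exact (Submodule.span ℚ _).zero_mem
  · have hsub : ({ramanujanP (1 / 2), ramanujanQ (1 / 2), ramanujanR (1 / 2)} : Set ℂ) ⊆
        Set.range ![(0 : ℂ)] ∪ Set.range (Complex.exp ∘ ![(0 : ℂ)]) ∪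
          Set.range ![ramanujanP (1 / 2)] ∪ Set.range ![ramanujanQ (1 / 2)] ∪
          Set.range ![ramanujanR (1 / 2)] := by
      rintro x (rfl | rfl | hx)
      · exact Or.inl (Or.inl (Or.inr ⟨0, rfl⟩))
      · exact Or.inl (Or.inr ⟨0, rfl⟩)
      · rw [Set.mem_singleton_iff] at hx; subst hx; exact Or.inr ⟨0, rfl⟩
    have hmono := trdeg_mono (F := ℚ) (E := ℂ) (adjoin.mono ℚ _ _ hsub)
    have h3 : ((1 + 0 + 3 * 1 - 1 : ℕ) : Cardinal) = 3 := by norm_num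
    rw [h3]
    exact three_le_trdeg_ramanujan_half.trans hmono

/-- **`LinearIndependent ℚ z` and the envelope bound cannot BOTH be dropped from crux
`NomeTransfer`**: the doubly-weakened statement is false at `n = 1`, `z = ![0]`, `k = 0`,
`e = ![]`, `w = ![0]` (`trdeg ℚ(0, e^0) = 0 < 1`). Since the proof of the crux never uses
`LinearIndependent ℚ z` (Disproof.lean §1: the mutation without it is still a theorem), this
locates the envelope bound `4(n+k) ≤ trdeg Env(w)` as load-bearing. [folklore] -/
theorem nomeTransfer_false_without_linIndep_and_envelope :
    ¬ (∀ (n : ℕ) (z : Fin n → ℂ) (k : ℕ) (e : Fin k → ℂ) (w : Fin (n + k) → ℂ),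
        (∀ i, IsAlgebraic ℚ (e i) ∨ IsAlgebraic ℚ (Complex.exp (e i))) →
        Submodule.span ℚ (Set.range w) = Submodule.span ℚ (Set.range z ∪ Set.range e) →
        (n : Cardinal) ≤ Algebra.trdeg ℚ ↥(IntermediateField.adjoin ℚ
          (Set.range z ∪ Set.range (Complex.exp ∘ z)))) := by
  intro h
  exact not_one_le_trdeg_exp_tuple_zero (h 1 ![0] 0 ![] ![0] (fun i => i.elim0) (by simp))

end Summit.Schanuel.Schanuel.Theorems.NomeTransfer.Negative

end
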